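/-
Copyright (c) 2026 the pub-hodgecm-mathlib formalisation cell (harness21).  Prover seat hodgecm-mathlib-K2E4-p10 (g4), Track B ∕ K2-LIT, h413 =
`stmt-HodgeConjecture-24833`, line `K2_E1_TraceFormulaBeta`, campaign «EIS-RANK-ONE», queue item (q11) «Kc-UNIFORM ARCH» §-last (the `U(J₂)` twin) of the dealer K2E1-plan (g4)
2026-09-04T07:14:46Z: `hφarch` of the spherical flat section of `U(1,1)` with ONE constant `C_φ` for all `‖z‖ ≤ R` (★ (a3)₂ p858035 hoisted; consumer (R3u) N = 2, ★ p858054 INFO #12).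
-/
import Summits.HodgeConjecture.HodgeConjecture.Theorems.K2E1HeightLineArchSmoothUniformU3   -- ★ p858234 (this seat): §2 `exists_norm_iteratedDeriv_affine_le_uniform_of_norm_le` (1-D, rank-free); imports ★ (a3)₃ §1 explicit Leibniz
import Summits.HodgeConjecture.HodgeConjecture.Theorems.K2E1HeightLineArchSmoothU2          -- ★ (a3)₂ p858035 (K2E1-p08 g5): the per-`z` version, §2 closed form along the `U(J₂)` line
import HarnessLib

/-!
# K2·E1 — `K2E1HeightLineArchSmoothUniformU2` ((q11) twin): `hφarch` FOR THE SPHERICAL FLAT SECTION OF `U(1,1)` WITH ONE `C_φ` ON `‖z‖ ≤ R`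
# (campaign «EIS-RANK-ONE»: ★ (a3)₂ `exists_archSmooth_flatSectionU_const_cm_two` with `∃ C_φ` HOISTED before `z`; the (R3u) N = 2 uniform-decay input)

Track B ∕ K2-LIT, crux h413 = `stmt-HodgeConjecture-24833`, route of record `HCCMUnconditional`; cell `hodgecm-mathlib`, squad K2, ENGINE E1.  Prover seat
`hodgecm-mathlib-K2E4-p10` (g4); queue item (q11) §-last of the dealer K2E1-plan (g4) 2026-09-04T07:14:46Z.  THEOREMS ONLY (no `def`, no `instance`, no notation, no named-fact
hypothesis, no `sorry`); lane `--supports stmt-HodgeConjecture-24833 --as helper` (count-neutral).  Closes no socket.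

THE MATHEMATICS [HormanderALPDO1, §7.1; MoeglinWaldspurger1995, I.2.10–I.2.12, II.1.5; Garrett2018, §2.2].  ★ (a3)₂'s per-place input ★ (D5-a1) `exists_norm_iteratedDeriv_le` has a
per-`z` constant and its tensor step ★ `exists_norm_iteratedFDeriv_finset_prod_le` an existential one; both are replaced by `z`-FREE data: the place symbols `(1 + c_w u²)^{−z}` are the
`A = 1` case of ★ p858234 §2 `exists_norm_iteratedDeriv_affine_le_uniform_of_norm_le` (ONE constant for `‖z‖ ≤ R`), and the Leibniz step is ★ (a3)₃ §1
`norm_iteratedFDeriv_finset_prod_le_explicit` (constant `(2ᵐ·C_max)^{#places}`).  The rest of ★ (a3)₂ §3 is re-run verbatim: **`exists_archSmooth_flatSectionU_const_cm_two_uniform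
(hij hN) (hcδ hδ) (φ₀) (m) (R) : ∃ C_φ ≥ 0, ∀ z, ‖z‖ ≤ R → ∀ k ∈ K_U, ∀ b, ContDiff ℝ m (…) ∧ ∀ j ≤ m, ∀ s, ‖Dʲ(…)(s)‖ ≤ C_φ·H(ι(w₀)·n(θ(ι⁻¹ s, b))·k)^{Re z}`**.
HONEST LABEL: HC_CM is proved only modulo the 7 printed citations (2 remaining named inputs: hLiu418 = `stmt-HodgeConjecture-24832`, h413 = `stmt-HodgeConjecture-24833`) until rung 0
closes; this file asserts no named fact and closes no socket.
References: [HormanderALPDO1] §7.1 · [MoeglinWaldspurger1995] I.2.10–I.2.12, II.1.5 · [Garrett2018] §2.2.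
-/

set_option autoImplicit false
-- the mandated namespace repeats the single-problem summit's segment (`HodgeConjecture.HodgeConjecture`)
set_option linter.dupNamespace false

noncomputable section

open NumberField NumberField.InfinitePlace NumberField.mixedEmbedding IsDedekindDomain
open Literature.NumberTheory.Automorphic Literature.NumberTheory.Automorphic.UnitaryGroup AdelicGroupData
open Summit.HodgeConjecture.HodgeConjecture.Cruxes.H413.K2E1BorelEisensteinU
open Summit.HodgeConjecture.HodgeConjecture.Cruxes.H413.K2E1HeightBigCellLineFormulaU2
open Summit.HodgeConjecture.HodgeConjecture.Cruxes.H413.K2E1OnePlusSqPowerSymbol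
open Summit.HodgeConjecture.HodgeConjecture.Cruxes.H413.K2E1TensorSymbolProduct
open Summit.HodgeConjecture.HodgeConjecture.Cruxes.H413.K2E1HeightLineArchSmoothU2
open Summit.HodgeConjecture.HodgeConjecture.Cruxes.H413.K2E1HeightLineArchSmoothU3 (norm_iteratedFDeriv_finset_prod_le_explicit)
open Summit.HodgeConjecture.HodgeConjecture.Cruxes.H413.K2E1HeightLineArchSmoothUniformU3 (exists_norm_iteratedDeriv_affine_le_uniform_of_norm_le)
-- `Classical` is needed to see the Mathlib normed-space instances on `mixedSpace` (note H5 of `AdelicGLnGlue`)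
open scoped NNReal ContDiff Classical

namespace Summit.HodgeConjecture.HodgeConjecture.Cruxes.H413.K2E1HeightLineArchSmoothUniformU2

variable (L : Type) [Field L] [NumberField L] [IsCMField L]
  (hij : (((0 : Fin 2) : ℕ)) + 1 = ((1 : Fin 2) : ℕ)) (hN : 2 = 2 * ((0 : Fin 2) : ℕ) + 2)

/-- **(q11) twin — THE ARCHIMEDEAN SMOOTHNESS BINDER `hφarch` FOR THE SPHERICAL FLAT SECTION OF `U(1,1)`, UNIFORMLY IN `z` ON `‖z‖ ≤ R`.**  For a CM field `L`, `δ ∈ L⁻ ∖ 0`,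
`φ₀ ∈ ℂ`, `m ∈ ℕ`, `R ∈ ℝ` there is ONE `C_φ ≥ 0` such that for EVERY `z` with `‖z‖ ≤ R`, every `k ∈ K_U` and every `b ∈ 𝔸_{L⁺}^∞` the function `(a ↦ f_z(ι(w₀)·n(θ(a, b))·k)) ∘ ι⁻¹`
on `mixedSpace L⁺` is `C^m` with `‖Dʲ(…)(s)‖ ≤ C_φ·H(ι(w₀)·n(θ(ι⁻¹ s, b))·k)^{Re z}` (`j ≤ m`) — ★ (a3)₂ `exists_archSmooth_flatSectionU_const_cm_two` with `∃ C_φ` hoisted before `z`.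
[cite: MoeglinWaldspurger1995, I.2.10–I.2.12, II.1.5] [cite: HormanderALPDO1, §7.1] [cite: Garrett2018, §2.2] -/
theorem exists_archSmooth_flatSectionU_const_cm_two_uniform {δ : L} (hcδ : IsCMField.complexConj L δ = -δ) (hδ : δ ≠ 0) (φ₀ : ℂ) (m : ℕ) (R : ℝ) :
    ∃ Cφ : ℝ, 0 ≤ Cφ ∧ ∀ z : ℂ, ‖z‖ ≤ R →
    ∀ k ∈ ((standardMaximalCompactGL 2 L).comap (adelicVal ↥(maximalRealSubfield L) L (IsCMField.complexConj L) 2 ((StdForm.antidiagonal 2).over L)) : Subgroup (quasiSplit (↥(maximalRealSubfield L)) L (IsCMField.complexConj L) 2).Adelic), ∀ b : FiniteAdeleRing (𝓞 ↥(maximalRealSubfield L)) ↥(maximalRealSubfield L),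
      ContDiff ℝ m ((fun a : InfiniteAdeleRing ↥(maximalRealSubfield L) => flatSectionU (fun _ : (quasiSplit (↥(maximalRealSubfield L)) L (IsCMField.complexConj L) 2).Adelic => φ₀) z (((quasiSplit (↥(maximalRealSubfield L)) L (IsCMField.complexConj L) 2).toAdelic (weylLongU ((IsCMField.complexConj L : L ≃ₐ[↥(maximalRealSubfield L)] L) : L →+* L) (rfl : ((StdForm.antidiagonal 2).over L) = ((StdForm.antidiagonal 2).over L)))) *
          ((middleRootUnipotent hij hN (Multiplicative.ofAdd (traceZeroLine ↥(maximalRealSubfield L) L (IsCMField.complexConj L) hcδ hδ ((a, b) : AdeleRing (𝓞 ↥(maximalRealSubfield L)) ↥(maximalRealSubfield L)))) : ↥(adelicUnipotent ↥(maximalRealSubfield L) L (IsCMField.complexConj L) 2)) : (quasiSplit (↥(maximalRealSubfield L)) L (IsCMField.complexConj L) 2).Adelic) * k)) ∘ (InfiniteAdeleRing.ringEquiv_mixedSpace ↥(maximalRealSubfield L)).symm) ∧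
      ∀ j : ℕ, j ≤ m → ∀ s : mixedSpace ↥(maximalRealSubfield L),
        ‖iteratedFDeriv ℝ j ((fun a : InfiniteAdeleRing ↥(maximalRealSubfield L) => flatSectionU (fun _ : (quasiSplit (↥(maximalRealSubfield L)) L (IsCMField.complexConj L) 2).Adelic => φ₀) z (((quasiSplit (↥(maximalRealSubfield L)) L (IsCMField.complexConj L) 2).toAdelic (weylLongU ((IsCMField.complexConj L : L ≃ₐ[↥(maximalRealSubfield L)] L) : L →+* L) (rfl : ((StdForm.antidiagonal 2).over L) = ((StdForm.antidiagonal 2).over L)))) *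
          ((middleRootUnipotent hij hN (Multiplicative.ofAdd (traceZeroLine ↥(maximalRealSubfield L) L (IsCMField.complexConj L) hcδ hδ ((a, b) : AdeleRing (𝓞 ↥(maximalRealSubfield L)) ↥(maximalRealSubfield L)))) : ↥(adelicUnipotent ↥(maximalRealSubfield L) L (IsCMField.complexConj L) 2)) : (quasiSplit (↥(maximalRealSubfield L)) L (IsCMField.complexConj L) 2).Adelic) * k)) ∘ (InfiniteAdeleRing.ringEquiv_mixedSpace ↥(maximalRealSubfield L)).symm) s‖ ≤
          Cφ * (borelHeight (((quasiSplit (↥(maximalRealSubfield L)) L (IsCMField.complexConj L) 2).toAdelic (weylLongU ((IsCMField.complexConj L : L ≃ₐ[↥(maximalRealSubfield L)] L) : L →+* L) (rfl : ((StdForm.antidiagonal 2).over L) = ((StdForm.antidiagonal 2).over L)))) *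
          ((middleRootUnipotent hij hN (Multiplicative.ofAdd (traceZeroLine ↥(maximalRealSubfield L) L (IsCMField.complexConj L) hcδ hδ (((InfiniteAdeleRing.ringEquiv_mixedSpace ↥(maximalRealSubfield L)).symm s, b) : AdeleRing (𝓞 ↥(maximalRealSubfield L)) ↥(maximalRealSubfield L)))) : ↥(adelicUnipotent ↥(maximalRealSubfield L) L (IsCMField.complexConj L) 2)) : (quasiSplit (↥(maximalRealSubfield L)) L (IsCMField.complexConj L) 2).Adelic) * k) : ℝ) ^ z.re := by
  -- (0) letters: the per-place constants `c_w = (w δ)² > 0`, coordinate forms `ℓ_w`, one-variable symbols `F_w`, their pull-backs `g_w`, envelopes `e_w`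
  set c : InfinitePlace L → ℝ := fun w => (w δ) ^ 2 with hc_def
  have hc : ∀ w, 0 < c w := fun w => sq_apply_pos_of_ne_zero L hδ w
  set ℓ : InfinitePlace L → (mixedSpace ↥(maximalRealSubfield L) →L[ℝ] ℝ) := fun w =>
    (ContinuousLinearMap.proj (R := ℝ) (φ := fun _ : {v : InfinitePlace ↥(maximalRealSubfield L) // v.IsReal} => ℝ)
        ⟨w.comap (algebraMap ↥(maximalRealSubfield L) L), K2E1HeightBigCellLineFormulaU2.isReal_comap_maximalRealSubfield L w⟩).comp
      (ContinuousLinearMap.fst ℝ ({v : InfinitePlace ↥(maximalRealSubfield L) // v.IsReal} → ℝ) ({v : InfinitePlace ↥(maximalRealSubfield L) // v.IsComplex} → ℂ)) with hℓ_def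
  have hℓ : ∀ w, ‖ℓ w‖ ≤ 1 := fun w => norm_proj_comp_fst_le_one ↥(maximalRealSubfield L) _
  have hℓ_apply : ∀ w (s : mixedSpace ↥(maximalRealSubfield L)), ℓ w s = s.1 ⟨w.comap (algebraMap ↥(maximalRealSubfield L) L), K2E1HeightBigCellLineFormulaU2.isReal_comap_maximalRealSubfield L w⟩ :=
    fun w s => rfl
  -- (1) one constant for all places and all orders `j ≤ m` (★ (D5-a1) per place and order, summed)
  choose C hC0 hC using fun w : InfinitePlace L => fun j : ℕ => exists_norm_iteratedDeriv_affine_le_uniform_of_norm_le (hc w) R j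
  set Cmax : ℝ := ∑ w : InfinitePlace L, ∑ j ∈ Finset.range (m + 1), C w j with hCmax_def
  have hCmax0 : 0 ≤ Cmax := Finset.sum_nonneg fun w _ => Finset.sum_nonneg fun j _ => hC0 w j
  have hCle : ∀ w, ∀ j ≤ m, C w j ≤ Cmax := by
    intro w j hj
    calc C w j ≤ ∑ j ∈ Finset.range (m + 1), C w j :=
          Finset.single_le_sum (f := fun j => C w j) (fun i _ => hC0 w i) (Finset.mem_range.2 (Nat.lt_succ_of_le hj))
      _ ≤ Cmax := Finset.single_le_sum (f := fun w => ∑ j ∈ Finset.range (m + 1), C w j) (fun w _ => Finset.sum_nonneg fun j _ => hC0 w j) (Finset.mem_univ w)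
  refine ⟨‖φ₀‖ * (2 ^ m * Cmax) ^ (Finset.univ : Finset (InfinitePlace L)).card, by positivity, fun z hzR k hk b => ?_⟩
  set F : InfinitePlace L → ℝ → ℂ := fun w u => ((((1 + c w * u ^ 2 : ℝ)) : ℂ) ^ (-z)) with hF_def
  have hF : ∀ w, ContDiff ℝ (m : ℕ∞) (F w) := fun w => contDiff_onePlusSqPow (hc w).le z
  set g : InfinitePlace L → mixedSpace ↥(maximalRealSubfield L) → ℂ := fun w => F w ∘ ℓ w with hg_def
  have hg : ∀ w ∈ (Finset.univ : Finset (InfinitePlace L)), ContDiff ℝ (m : ℕ∞) (g w) := fun w _ => (hF w).comp (ℓ w).contDiff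
  set e : InfinitePlace L → mixedSpace ↥(maximalRealSubfield L) → ℝ := fun w s => (1 + c w * (ℓ w s) ^ 2) ^ (-z.re) with he_def
  have he : ∀ w ∈ (Finset.univ : Finset (InfinitePlace L)), ∀ s, 0 ≤ e w s := fun w _ s => Real.rpow_nonneg (onePlusSq_pos (hc w).le _).le _
  have hb : ∀ w ∈ (Finset.univ : Finset (InfinitePlace L)), ∀ j ≤ m, ∀ s, ‖iteratedFDeriv ℝ j (g w) s‖ ≤ Cmax * e w s := by
    intro w _ j hj s
    have hjm : (j : WithTop ℕ∞) ≤ (m : ℕ∞) := by exact_mod_cast hj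
    calc ‖iteratedFDeriv ℝ j (g w) s‖ ≤ ‖iteratedDeriv j (F w) (ℓ w s)‖ := norm_iteratedFDeriv_comp_form_le (hF w) (ℓ w) (hℓ w) s hjm
      _ ≤ C w j * (1 + c w * (ℓ w s) ^ 2) ^ (-z.re) := hC w j z hzR 1 le_rfl (c w) (hc w) le_rfl (ℓ w s)
      _ ≤ Cmax * e w s := mul_le_mul_of_nonneg_right (hCle w j hj) (he w (Finset.mem_univ w) s)
  -- (2) the tensor Leibniz rule with the EXPLICIT constant `(2ᵐ·C_max)^{#places}` (★ (a3)₃ §1) — independent of `z`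
  obtain ⟨hprod, hbound⟩ := norm_iteratedFDeriv_finset_prod_le_explicit (Finset.univ : Finset (InfinitePlace L)) hg (le_refl _) hCmax0 he hb
  -- (3) the finite factor `h_f(b) ≥ 1`
  have hhf0 : 0 < ((∏ᶠ v : HeightOneSpectrum (𝓞 L), max 1 ‖((traceZeroLine ↥(maximalRealSubfield L) L (IsCMField.complexConj L) hcδ hδ ((0, b) : AdeleRing (𝓞 ↥(maximalRealSubfield L)) ↥(maximalRealSubfield L)) : traceZeroAdele ↥(maximalRealSubfield L) L (IsCMField.complexConj L)) : AdeleRing (𝓞 L) L).2 v‖₊ : ℝ≥0) : ℝ) :=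
    zero_lt_one.trans_le (one_le_coe_finprod_line_cm_two L hcδ hδ b)
  -- (4) the line function IS `A • ∏_w g_w` (§2)
  have hfun : ((fun a : InfiniteAdeleRing ↥(maximalRealSubfield L) => flatSectionU (fun _ : (quasiSplit (↥(maximalRealSubfield L)) L (IsCMField.complexConj L) 2).Adelic => φ₀) z (((quasiSplit (↥(maximalRealSubfield L)) L (IsCMField.complexConj L) 2).toAdelic (weylLongU ((IsCMField.complexConj L : L ≃ₐ[↥(maximalRealSubfield L)] L) : L →+* L) (rfl : ((StdForm.antidiagonal 2).over L) = ((StdForm.antidiagonal 2).over L)))) *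
          ((middleRootUnipotent hij hN (Multiplicative.ofAdd (traceZeroLine ↥(maximalRealSubfield L) L (IsCMField.complexConj L) hcδ hδ ((a, b) : AdeleRing (𝓞 ↥(maximalRealSubfield L)) ↥(maximalRealSubfield L)))) : ↥(adelicUnipotent ↥(maximalRealSubfield L) L (IsCMField.complexConj L) 2)) : (quasiSplit (↥(maximalRealSubfield L)) L (IsCMField.complexConj L) 2).Adelic) * k)) ∘ (InfiniteAdeleRing.ringEquiv_mixedSpace ↥(maximalRealSubfield L)).symm) =
      (φ₀ * (((((∏ᶠ v : HeightOneSpectrum (𝓞 L), max 1 ‖((traceZeroLine ↥(maximalRealSubfield L) L (IsCMField.complexConj L) hcδ hδ ((0, b) : AdeleRing (𝓞 ↥(maximalRealSubfield L)) ↥(maximalRealSubfield L)) : traceZeroAdele ↥(maximalRealSubfield L) L (IsCMField.complexConj L)) : AdeleRing (𝓞 L) L).2 v‖₊ : ℝ≥0) : ℝ)⁻¹ : ℝ) : ℂ) ^ z)) • fun s => ∏ w, g w s := by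
    funext s
    rw [flatSectionU_const_line_apply_cm_two L hij hN hcδ hδ z φ₀ hk b s, Pi.smul_apply, smul_eq_mul, mul_assoc]
    rfl
  -- (5) smoothness
  have hcd : ContDiff ℝ m ((φ₀ * (((((∏ᶠ v : HeightOneSpectrum (𝓞 L), max 1 ‖((traceZeroLine ↥(maximalRealSubfield L) L (IsCMField.complexConj L) hcδ hδ ((0, b) : AdeleRing (𝓞 ↥(maximalRealSubfield L)) ↥(maximalRealSubfield L)) : traceZeroAdele ↥(maximalRealSubfield L) L (IsCMField.complexConj L)) : AdeleRing (𝓞 L) L).2 v‖₊ : ℝ≥0) : ℝ)⁻¹ : ℝ) : ℂ) ^ z)) • fun s => ∏ w, g w s) := hprod.const_smul (φ₀ * (((((∏ᶠ v : HeightOneSpectrum (𝓞 L), max 1 ‖((traceZeroLine ↥(maximalRealSubfield L) L (IsCMField.complexConj L) hcδ hδ ((0, b) : AdeleRing (𝓞 ↥(maximalRealSubfield L)) ↥(maximalRealSubfield L)) : traceZeroAdele ↥(maximalRealSubfield L) L (IsCMField.complexConj L)) : AdeleRing (𝓞 L) L).2 v‖₊ : ℝ≥0) : ℝ)⁻¹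 : ℝ) : ℂ) ^ z))
  refine ⟨by rw [hfun]; exact hcd, fun j hj s => ?_⟩
  rw [hfun, iteratedFDeriv_const_smul_apply ((hprod.of_le (by exact_mod_cast hj)).contDiffAt), _root_.norm_smul]
  -- (6) the estimate: `‖A‖·‖Dʲ∏‖ ≤ ‖A‖·(2ᵐC_max)^#·∏ e_w = ‖φ₀‖·(2ᵐC_max)^#·H^{Re z}`
  have hprodb := hbound j hj s
  have hA : ‖(φ₀ * (((((∏ᶠ v : HeightOneSpectrum (𝓞 L), max 1 ‖((traceZeroLine ↥(maximalRealSubfield L) L (IsCMField.complexConj L) hcδ hδ ((0, b) : AdeleRing (𝓞 ↥(maximalRealSubfield L)) ↥(maximalRealSubfield L)) : traceZeroAdele ↥(maximalRealSubfield L) L (IsCMField.complexConj L)) : AdeleRing (𝓞 L) L).2 v‖₊ : ℝ≥0) : ℝ)⁻¹ : ℝ) : ℂ) ^ z))‖ = ‖φ₀‖ * ‖(((((∏ᶠ v : HeightOneSpectrum (𝓞 L), max 1 ‖((traceZeroLine ↥(maximalRealSubfield L) L (IsCMField.complexConj L) hcδ hδ ((0, b) : AdeleRing (𝓞 ↥(maximalRealSubfield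 L)) ↥(maximalRealSubfield L)) : traceZeroAdele ↥(maximalRealSubfield L) L (IsCMField.complexConj L)) : AdeleRing (𝓞 L) L).2 v‖₊ : ℝ≥0) : ℝ)⁻¹ : ℝ)) : ℂ) ^ z‖ := norm_mul _ _
  have hH : ‖(((((∏ᶠ v : HeightOneSpectrum (𝓞 L), max 1 ‖((traceZeroLine ↥(maximalRealSubfield L) L (IsCMField.complexConj L) hcδ hδ ((0, b) : AdeleRing (𝓞 ↥(maximalRealSubfield L)) ↥(maximalRealSubfield L)) : traceZeroAdele ↥(maximalRealSubfield L) L (IsCMField.complexConj L)) : AdeleRing (𝓞 L) L).2 v‖₊ : ℝ≥0) : ℝ)⁻¹ : ℝ)) : ℂ) ^ z‖ * ∏ w, e w s =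
      (borelHeight (((quasiSplit (↥(maximalRealSubfield L)) L (IsCMField.complexConj L) 2).toAdelic (weylLongU ((IsCMField.complexConj L : L ≃ₐ[↥(maximalRealSubfield L)] L) : L →+* L) (rfl : ((StdForm.antidiagonal 2).over L) = ((StdForm.antidiagonal 2).over L)))) *
          ((middleRootUnipotent hij hN (Multiplicative.ofAdd (traceZeroLine ↥(maximalRealSubfield L) L (IsCMField.complexConj L) hcδ hδ (((InfiniteAdeleRing.ringEquiv_mixedSpace ↥(maximalRealSubfield L)).symm s, b) : AdeleRing (𝓞 ↥(maximalRealSubfield L)) ↥(maximalRealSubfield L)))) : ↥(adelicUnipotent ↥(maximalRealSubfield L) L (IsCMField.complexConj L) 2)) : (quasiSplit (↥(maximalRealSubfield L)) L (IsCMField.complexConj L) 2).Adelic) * k) : ℝ) ^ z.re := by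
    rw [coe_borelHeight_weylLongU_line_mul_eq_cm_two L hij hN hcδ hδ hk b s,
      ← norm_ofReal_inv_cpow_mul_prod_rpow_neg Finset.univ (fun w _ => (onePlusSq_pos (hc w).le _).le) hhf0 z]
    rfl
  calc ‖(φ₀ * (((((∏ᶠ v : HeightOneSpectrum (𝓞 L), max 1 ‖((traceZeroLine ↥(maximalRealSubfield L) L (IsCMField.complexConj L) hcδ hδ ((0, b) : AdeleRing (𝓞 ↥(maximalRealSubfield L)) ↥(maximalRealSubfield L)) : traceZeroAdele ↥(maximalRealSubfield L) L (IsCMField.complexConj L)) : AdeleRing (𝓞 L) L).2 v‖₊ : ℝ≥0) : ℝ)⁻¹ : ℝ) : ℂ) ^ z))‖ * ‖iteratedFDeriv ℝ j (fun s => ∏ w, g w s) s‖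
        ≤ ‖(φ₀ * (((((∏ᶠ v : HeightOneSpectrum (𝓞 L), max 1 ‖((traceZeroLine ↥(maximalRealSubfield L) L (IsCMField.complexConj L) hcδ hδ ((0, b) : AdeleRing (𝓞 ↥(maximalRealSubfield L)) ↥(maximalRealSubfield L)) : traceZeroAdele ↥(maximalRealSubfield L) L (IsCMField.complexConj L)) : AdeleRing (𝓞 L) L).2 v‖₊ : ℝ≥0) : ℝ)⁻¹ : ℝ) : ℂ) ^ z))‖ * ((2 ^ m * Cmax) ^ (Finset.univ : Finset (InfinitePlace L)).card * ∏ w, e w s) := mul_le_mul_of_nonneg_left hprodb (norm_nonneg _)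
    _ = ‖φ₀‖ * (2 ^ m * Cmax) ^ (Finset.univ : Finset (InfinitePlace L)).card * (‖(((((∏ᶠ v : HeightOneSpectrum (𝓞 L), max 1 ‖((traceZeroLine ↥(maximalRealSubfield L) L (IsCMField.complexConj L) hcδ hδ ((0, b) : AdeleRing (𝓞 ↥(maximalRealSubfield L)) ↥(maximalRealSubfield L)) : traceZeroAdele ↥(maximalRealSubfield L) L (IsCMField.complexConj L)) : AdeleRing (𝓞 L) L).2 v‖₊ : ℝ≥0) : ℝ)⁻¹ : ℝ)) : ℂ) ^ z‖ * ∏ w, e w s) := by rw [hA]; ring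
    _ = _ := by rw [hH]


end Summit.HodgeConjecture.HodgeConjecture.Cruxes.H413.K2E1HeightLineArchSmoothUniformU2

end
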